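import Summits.HubbardSuperconductivity.HubbardSuperconductivity.Theorems.AnisotropyChordTowerTransposition
import Summits.HubbardSuperconductivity.HubbardSuperconductivity.Theorems.AnisotropyChordTotalSpinTransfer

/-!
# Route `AnisotropyChord` / H0 rotor rung: THE DEFICIT IDENTITY — the spin deficit of a sector amplitude is twice the
# complete-graph interchange form (port of theory seat `hubbard-h0-rotor-theory-1`, cycle 11, `PartH6.lean`, memo
# ROTOR-THEORY-11 §156/§160; work-order v12b; director CYCLE-12 ruling (A))

`comp_swap_eq_update` (particle move = remove + add), `lowerSum_update_one_eq`, `sum_holes_swap_eq_neg`, **LEMMA J2**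
`fmOp_top_lowestWeight_two` (lowest-weight two-magnon `v`: `A_⊤ v = (|V|−1)·v`), `raiseSum_lowerSum_eq`, `fmOp_top_pointwise`,
**DEFICIT IDENTITY** `raiseSum_lowerSum_add_two_fmOp_top` (pointwise `S⁺S⁻ + 2A_⊤ = Z(|V|−Z)+Z`),
`lowerNormSq_add_two_inner_fmOp_top`, `totalSpinSq_eq_sub_two_inner_fmOp_top` (`|V| = 2S`, unit `a` in sector `M`:
`totalSpinSq a M = S(S+1) − 2⟨a, A_⊤ a⟩`).  With `…TowerTransposition/Counting/SectorFun` every combinatorial input of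
THEOREM P′ (RUNG XY-LM_FM) is in the tree.  Typing/proof authority: theory seat.
-/

set_option linter.dupNamespace false
set_option linter.unusedSectionVars false
set_option linter.unusedVariables false
set_option autoImplicit false

noncomputable section

open Finset
open Summit.HubbardSuperconductivity.HubbardSuperconductivity.Theorems.AnisotropyChord.InsertionEntropy

namespace Summit.HubbardSuperconductivity.HubbardSuperconductivity.Theorems.AnisotropyChord.Tower

variable {V : Type} [Fintype V] [DecidableEq V]

/-- Every element of `Fin 2` is `0` or `1`. [folklore] -/
private theorem fin2_cases' (i : Fin 2) : i = 0 ∨ i = 1 := by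
  rcases i with ⟨_ | _ | k, hk⟩
  · left; rfl
  · right; rfl
  · omega

variable (G : SimpleGraph V) [DecidableRel G.Adj]

/-! ### H.6 the complete-graph form on two-magnon lowest-weight vectors and the DEFICIT IDENTITY -/

/-- swapping two sites with equal occupation does nothing. -/
theorem comp_swap_of_eq (σ : V → Fin 2) {x y : V} (h : σ x = σ y) : σ ∘ ⇑(Equiv.swap x y) = σ := by
  funext z; simp only [Function.comp_apply, Equiv.swap_apply_def]
  by_cases h1 : z = x
  · subst h1; simp [h]
  · by_cases h2 : z = y
    · subst h2; simp [h1, h]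
    · simp [h1, h2]

/-- moving a particle from `x` (occupied) to `y` (empty) = remove at `x`, then add at `y`. -/
theorem comp_swap_eq_update (σ : V → Fin 2) {x y : V} (hx : σ x = 0) (hy : σ y = 1) :
    σ ∘ ⇑(Equiv.swap x y) = Function.update (Function.update σ x 1) y 0 := by
  have hxy : x ≠ y := by intro e; rw [e, hy] at hx; exact absurd hx (by decide)
  funext z; simp only [Function.comp_apply, Equiv.swap_apply_def]
  by_cases h1 : z = x
  · subst h1; simp [hxy, hy]
  · by_cases h2 : z = y
    · subst h2; simp [h1, hx]
    · simp [h1, h2]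

/-- the particle–hole sum of a lowest-weight two-magnon vector: `Σ_{y : σ y = 1} v(σ ∘ (x y)) = −v σ` for `σ x = 0`. -/
theorem sum_holes_swap_eq_neg (v : (V → Fin 2) → ℝ) (hlow : lowerSum v = fun _ => 0)
    (σ : V → Fin 2) {x : V} (hx : σ x = 0) :
    (∑ y, if σ y = 1 then v (σ ∘ ⇑(Equiv.swap x y)) else 0) = - v σ := by
  have hl := congrFun hlow (Function.update σ x 1)
  unfold lowerSum at hl
  -- split off the y = x term of the lowerSum
  have hsplit : (∑ y, if Function.update σ x 1 y = 1 then v (Function.update (Function.update σ x 1) y 0) else 0)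
      = v σ + ∑ y, if σ y = 1 then v (σ ∘ ⇑(Equiv.swap x y)) else 0 := by
    rw [← Finset.add_sum_erase (a := x) _ _ (Finset.mem_univ x)]
    congr 1
    · simp only [Function.update_self, if_true, Function.update_idem]
      rw [Function.update_eq_self_iff.mpr hx.symm]
    · rw [← Finset.sum_erase (s := univ) (a := x) (f := fun y => if σ y = 1 then v (σ ∘ ⇑(Equiv.swap x y)) else 0)
          (by simp [hx])]
      refine Finset.sum_congr rfl fun y hy => ?_
      have hyx : y ≠ x := Finset.ne_of_mem_erase hy
      rw [Function.update_of_ne hyx]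
      by_cases hy1 : σ y = 1
      · simp only [hy1, if_true, comp_swap_eq_update σ hx hy1]
      · simp [hy1]
  rw [hsplit] at hl; linarith

/-- **LEMMA J2**: on a lowest-weight two-magnon vector the complete-graph form acts as the scalar `|V| − 1`
(`= 2S − 1`; so `s₀ − S⃗² = 2 A_⊤` acts as `4S − 2` on spin `S − 2`). -/
theorem fmOp_top_lowestWeight_two (v : (V → Fin 2) → ℝ)
    (hsupp : ∀ ν, v ν ≠ 0 → zerosCard ν = 2) (hlow : lowerSum v = fun _ => 0) :
    fmOp (⊤ : SimpleGraph V) v = fun σ => ((Fintype.card V : ℝ) - 1) * v σ := by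
  funext σ
  unfold fmOp
  simp only [SimpleGraph.top_adj]
  -- pointwise value of the summand
  have hterm : ∀ x y : V, (if x ≠ y then v σ - v (σ ∘ ⇑(Equiv.swap x y)) else 0)
      = (if σ x = 0 then (if σ y = 1 then v σ - v (σ ∘ ⇑(Equiv.swap x y)) else 0) else 0)
        + (if σ x = 1 then (if σ y = 0 then v σ - v (σ ∘ ⇑(Equiv.swap x y)) else 0) else 0) := by
    intro x y
    by_cases hxy : x = y
    · subst hxy; rcases fin2_cases' (σ x) with h | h <;> simp [h]
    · simp only [hxy, ne_eq, not_false_eq_true, if_true]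
      rcases fin2_cases' (σ x) with hx | hx <;> rcases fin2_cases' (σ y) with hy | hy
      · simp [hx, hy, comp_swap_of_eq σ (hx.trans hy.symm)]
      · simp [hx, hy]
      · simp [hx, hy]
      · simp [hx, hy, comp_swap_of_eq σ (hx.trans hy.symm)]
  simp_rw [hterm, Finset.sum_add_distrib]
  -- first block: x particle, y hole
  have hA : ∀ x, (∑ y, if σ x = 0 then (if σ y = 1 then v σ - v (σ ∘ ⇑(Equiv.swap x y)) else 0) else (0:ℝ))
      = if σ x = 0 then ((((Fintype.card V : ℝ)) - zerosCard σ) * v σ + v σ) else 0 := by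
    intro x
    by_cases hx : σ x = 0
    · simp only [hx, if_true]
      have h1 : (∑ y, if σ y = 1 then v σ - v (σ ∘ ⇑(Equiv.swap x y)) else (0:ℝ))
          = (∑ y, if σ y = 1 then v σ else (0:ℝ)) - ∑ y, if σ y = 1 then v (σ ∘ ⇑(Equiv.swap x y)) else 0 := by
        rw [← Finset.sum_sub_distrib]; refine Finset.sum_congr rfl fun y _ => ?_; split_ifs <;> simp
      rw [h1, sum_holes_swap_eq_neg v hlow σ hx]
      rw [← Finset.sum_filter, Finset.sum_const, nsmul_eq_mul]
      have hcount : ((univ.filter fun y : V => σ y = 1).card : ℝ) = (Fintype.card V : ℝ) - zerosCard σ := by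
        unfold zerosCard
        have := Finset.card_filter_add_card_filter_not (s := (univ : Finset V)) (fun y => σ y = 0)
        have hneg : (univ.filter fun y : V => ¬ σ y = 0) = univ.filter fun y => σ y = 1 := by
          ext y; simp only [Finset.mem_filter, Finset.mem_univ, true_and]
          rcases fin2_cases' (σ y) with h | h <;> simp [h]
        rw [hneg, Finset.card_univ] at this
        have := congrArg (fun n : ℕ => (n : ℝ)) this; push_cast at this; linarith
      rw [hcount]; ring
    · simp [hx]
  -- second block: x hole, y particle — rename and use swap x y = swap y x
  have hB : (∑ x, ∑ y, if σ x = 1 then (if σ y = 0 then v σ - v (σ ∘ ⇑(Equiv.swap x y)) else 0) else (0:ℝ))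
      = ∑ y, ∑ x, if σ y = 0 then (if σ x = 1 then v σ - v (σ ∘ ⇑(Equiv.swap y x)) else 0) else (0:ℝ) := by
    rw [Finset.sum_comm]
    refine Finset.sum_congr rfl fun y _ => Finset.sum_congr rfl fun x _ => ?_
    by_cases hy : σ y = 0 <;> by_cases hx : σ x = 1 <;> simp [hx, hy, Equiv.swap_comm]
  rw [hB]
  simp_rw [hA]
  rw [← Finset.sum_add_distrib]
  have hsame : ∀ x, ((if σ x = 0 then ((Fintype.card V : ℝ) - zerosCard σ) * v σ + v σ else 0)
      + (if σ x = 0 then ((Fintype.card V : ℝ) - zerosCard σ) * v σ + v σ else 0))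
      = (if σ x = 0 then (1:ℝ) else 0) * (2 * (((Fintype.card V : ℝ) - zerosCard σ) * v σ + v σ)) := by
    intro x; split_ifs <;> ring
  simp_rw [hsame]
  rw [← Finset.sum_mul]
  have hz : (∑ x, if σ x = 0 then (1:ℝ) else 0) = zerosCard σ := by
    unfold zerosCard; rw [← Finset.sum_filter]; simp
  rw [hz]
  by_cases hv : v σ = 0
  · simp [hv]
  · rw [hsupp σ hv]; ring

/-- the removal sum after adding a particle at an occupied-by-hole site `x`: the `y = x` term returns `σ`,
the other terms are the particle moves `y → x`. (general amplitude `a`) -/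
theorem lowerSum_update_one_eq (a : (V → Fin 2) → ℝ) (σ : V → Fin 2) {x : V} (hx : σ x = 0) :
    lowerSum a (Function.update σ x 1) = a σ + ∑ y, if σ y = 1 then a (σ ∘ ⇑(Equiv.swap x y)) else 0 := by
  unfold lowerSum
  rw [← Finset.add_sum_erase (a := x) _ _ (Finset.mem_univ x)]
  congr 1
  · simp only [Function.update_self, if_true, Function.update_idem]
    rw [Function.update_eq_self_iff.mpr hx.symm]
  · rw [← Finset.sum_erase (s := univ) (a := x) (f := fun y => if σ y = 1 then a (σ ∘ ⇑(Equiv.swap x y)) else 0)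
        (by simp [hx])]
    refine Finset.sum_congr rfl fun y hy => ?_
    have hyx : y ≠ x := Finset.ne_of_mem_erase hy
    rw [Function.update_of_ne hyx]
    by_cases hy1 : σ y = 1
    · simp only [hy1, if_true, comp_swap_eq_update σ hx hy1]
    · simp [hy1]

/-- `S⁺S⁻` pointwise: `(raiseSum (lowerSum a)) σ = Z(σ)·a σ + Σ_{x hole? no: x ∈ zeros}Σ_{y occupied… }` — precisely
`= zerosCard σ · a σ + Σ_x Σ_y [σ x = 0][σ y = 1] a(σ ∘ (x y))`. -/
theorem raiseSum_lowerSum_eq (a : (V → Fin 2) → ℝ) (σ : V → Fin 2) :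
    raiseSum (lowerSum a) σ = zerosCard σ * a σ
      + ∑ x, ∑ y, if σ x = 0 then (if σ y = 1 then a (σ ∘ ⇑(Equiv.swap x y)) else 0) else 0 := by
  unfold raiseSum
  have h : ∀ x, (if σ x = 0 then lowerSum a (Function.update σ x 1) else 0)
      = (if σ x = 0 then (1:ℝ) else 0) * a σ
        + ∑ y, if σ x = 0 then (if σ y = 1 then a (σ ∘ ⇑(Equiv.swap x y)) else 0) else 0 := by
    intro x
    by_cases hx : σ x = 0
    · simp only [hx, if_true, one_mul, lowerSum_update_one_eq a σ hx]
    · simp [hx]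
  simp_rw [h]
  rw [Finset.sum_add_distrib, ← Finset.sum_mul]
  congr 1
  unfold zerosCard; rw [← Finset.sum_filter]; simp

/-- the complete-graph form pointwise, in particle–hole variables:
`fmOp ⊤ b σ = ½ Σ_x Σ_y [σ x = 0][σ y = 1] (b σ − b(σ ∘ (x y)))`. -/
theorem fmOp_top_pointwise (b : (V → Fin 2) → ℝ) (σ : V → Fin 2) :
    fmOp (⊤ : SimpleGraph V) b σ
      = (1/2 : ℝ) * ∑ x, ∑ y, if σ x = 0 then (if σ y = 1 then b σ - b (σ ∘ ⇑(Equiv.swap x y)) else 0) else 0 := by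
  unfold fmOp
  simp only [SimpleGraph.top_adj]
  have hterm : ∀ x y : V, (if x ≠ y then b σ - b (σ ∘ ⇑(Equiv.swap x y)) else 0)
      = (if σ x = 0 then (if σ y = 1 then b σ - b (σ ∘ ⇑(Equiv.swap x y)) else 0) else 0)
        + (if σ x = 1 then (if σ y = 0 then b σ - b (σ ∘ ⇑(Equiv.swap x y)) else 0) else 0) := by
    intro x y
    by_cases hxy : x = y
    · subst hxy; rcases fin2_cases' (σ x) with h | h <;> simp [h]
    · simp only [hxy, ne_eq, not_false_eq_true, if_true]
      rcases fin2_cases' (σ x) with hx | hx <;> rcases fin2_cases' (σ y) with hy | hy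
      · simp [hx, hy, comp_swap_of_eq σ (hx.trans hy.symm)]
      · simp [hx, hy]
      · simp [hx, hy]
      · simp [hx, hy, comp_swap_of_eq σ (hx.trans hy.symm)]
  simp_rw [hterm, Finset.sum_add_distrib]
  have hB : (∑ x, ∑ y, if σ x = 1 then (if σ y = 0 then b σ - b (σ ∘ ⇑(Equiv.swap x y)) else 0) else (0:ℝ))
      = ∑ y, ∑ x, if σ y = 0 then (if σ x = 1 then b σ - b (σ ∘ ⇑(Equiv.swap y x)) else 0) else (0:ℝ) := by
    rw [Finset.sum_comm]
    refine Finset.sum_congr rfl fun y _ => Finset.sum_congr rfl fun x _ => ?_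
    by_cases hy : σ y = 0 <;> by_cases hx : σ x = 1 <;> simp [hx, hy, Equiv.swap_comm]
  rw [hB]; ring

/-- **DEFICIT IDENTITY (pointwise form)**: `S⁺S⁻ + 2·A_⊤ = Z(|V| − Z) + Z` as operators on amplitudes, i.e.
`raiseSum (lowerSum a) σ + 2·fmOp ⊤ a σ = (Z(σ)(|V| − Z(σ)) + Z(σ))·a σ`.  Summed against `a` (adjointness
`sum_mul_lowerSum_eq_sum_raiseSum_mul`) this is `lowerNormSq a + 2⟨a, A_⊤ a⟩ = Σ_σ (Z(|V|−Z)+Z) a σ²`, and on the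
`n`-sector with `|V| = 2S`, `n = S + M`: `totalSpinSq a M = S(S+1)·‖a‖² − 2⟨a, A_⊤ a⟩` — the spin deficit is twice the
complete-graph interchange form (memo §160 LEMMA DEF, THEOREMS M11). -/
theorem raiseSum_lowerSum_add_two_fmOp_top (a : (V → Fin 2) → ℝ) (σ : V → Fin 2) :
    raiseSum (lowerSum a) σ + 2 * fmOp (⊤ : SimpleGraph V) a σ
      = (zerosCard σ * ((Fintype.card V : ℝ) - zerosCard σ) + zerosCard σ) * a σ := by
  rw [raiseSum_lowerSum_eq, fmOp_top_pointwise]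
  have hsplit : ∀ x y, (if σ x = 0 then (if σ y = 1 then a σ - a (σ ∘ ⇑(Equiv.swap x y)) else 0) else (0:ℝ))
      = (if σ x = 0 then (1:ℝ) else 0) * (if σ y = 1 then (1:ℝ) else 0) * a σ
        - (if σ x = 0 then (if σ y = 1 then a (σ ∘ ⇑(Equiv.swap x y)) else 0) else 0) := by
    intro x y; split_ifs <;> ring
  simp_rw [hsplit, Finset.sum_sub_distrib]
  have hmain : (∑ x, ∑ y, (if σ x = 0 then (1:ℝ) else 0) * (if σ y = 1 then (1:ℝ) else 0) * a σ)
      = (∑ x, if σ x = 0 then (1:ℝ) else 0) * (∑ y, if σ y = 1 then (1:ℝ) else 0) * a σ := by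
    rw [Finset.sum_mul, Finset.sum_mul]
    refine Finset.sum_congr rfl fun x _ => ?_
    rw [Finset.mul_sum, Finset.sum_mul]
  rw [hmain]
  have hz : (∑ x, if σ x = 0 then (1:ℝ) else 0) = zerosCard σ := by
    unfold zerosCard; rw [← Finset.sum_filter]; simp
  have hone : (∑ y, if σ y = 1 then (1:ℝ) else 0) = (Fintype.card V : ℝ) - zerosCard σ := by
    unfold zerosCard
    have := Finset.card_filter_add_card_filter_not (s := (univ : Finset V)) (fun y => σ y = 0)
    have hneg : (univ.filter fun y : V => ¬ σ y = 0) = univ.filter fun y => σ y = 1 := by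
      ext y; simp only [Finset.mem_filter, Finset.mem_univ, true_and]
      rcases fin2_cases' (σ y) with h | h <;> simp [h]
    rw [hneg, Finset.card_univ] at this
    have := congrArg (fun n : ℕ => (n : ℝ)) this; push_cast at this
    rw [← Finset.sum_filter]; simp; linarith
  rw [hz, hone]; ring

/-- **DEFICIT IDENTITY (quadratic form)** on the `n`-sector:
`lowerNormSq a + 2 Σ_σ a σ · (A_⊤ a) σ = n(|V| − n + 1) · Σ_σ a σ²`. With `|V| = 2S`, `n = S + M` and
`totalSpinSq a M = lowerNormSq a + M² − M` (tree): `totalSpinSq a M = S(S+1)‖a‖² − 2⟨a, A_⊤ a⟩`. -/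
theorem lowerNormSq_add_two_inner_fmOp_top (a : (V → Fin 2) → ℝ) (n : ℕ)
    (hsupp : ∀ ν, a ν ≠ 0 → zerosCard ν = n) :
    lowerNormSq a + 2 * ∑ σ, a σ * fmOp (⊤ : SimpleGraph V) a σ
      = (n : ℝ) * ((Fintype.card V : ℝ) - n + 1) * ∑ σ, a σ ^ 2 := by
  have hadj : lowerNormSq a = ∑ σ, raiseSum (lowerSum a) σ * a σ := by
    unfold lowerNormSq
    rw [← sum_mul_lowerSum_eq_sum_raiseSum_mul]
    refine Finset.sum_congr rfl fun τ _ => ?_; ring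
  rw [hadj, Finset.mul_sum, ← Finset.sum_add_distrib, Finset.mul_sum]
  refine Finset.sum_congr rfl fun σ _ => ?_
  have h := raiseSum_lowerSum_add_two_fmOp_top a σ
  by_cases ha : a σ = 0
  · simp [ha]
  · have hz := hsupp σ ha
    have : raiseSum (lowerSum a) σ * a σ + 2 * (a σ * fmOp ⊤ a σ)
        = (raiseSum (lowerSum a) σ + 2 * fmOp ⊤ a σ) * a σ := by ring
    rw [this, h, hz]; ring

/-- COROLLARY: `totalSpinSq a M = S(S+1) − 2⟨a, A_⊤ a⟩` for a unit amplitude on the sector `n = S + M`, `|V| = 2S`. -/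
theorem totalSpinSq_eq_sub_two_inner_fmOp_top (a : (V → Fin 2) → ℝ) (S M : ℝ) (n : ℕ)
    (hV : (Fintype.card V : ℝ) = 2 * S) (hn : (n : ℝ) = S + M)
    (hsupp : ∀ ν, a ν ≠ 0 → zerosCard ν = n) (hunit : ∑ σ, a σ ^ 2 = 1) :
    totalSpinSq a M = S * (S + 1) - 2 * ∑ σ, a σ * fmOp (⊤ : SimpleGraph V) a σ := by
  unfold totalSpinSq
  have h := lowerNormSq_add_two_inner_fmOp_top a n hsupp
  rw [hunit, hV, hn] at h
  nlinarith [h]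

end Summit.HubbardSuperconductivity.HubbardSuperconductivity.Theorems.AnisotropyChord.Tower
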